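import Summits.NavierStokesRegularity.NavierStokesRegularity.Theorems.CoriolisHeadNoCoRotatingCoreSpinVorticity
import Summits.NavierStokesRegularity.NavierStokesRegularity.Theorems.CoriolisHeadNoCoRotatingCoreGradientBound
import Summits.NavierStokesRegularity.NavierStokesRegularity.Theorems.CoriolisHeadNoCoRotatingCoreReduction
import Summits.NavierStokesRegularity.NavierStokesRegularity.Theorems.CoriolisHeadCounterRotatingLiouvilleSkewLiouville
import Summits.NavierStokesRegularity.NavierStokesRegularity.Theorems.CoriolisHeadCounterRotatingLiouvilleEndgame
import Literature.Analysis.FluidPDE.LerayProfileCalculus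
import Literature.Analysis.FluidPDE.CurlFreeLiouville

/-!
# Route CoriolisHead · crux `NoCoRotatingCore` (stmt-NavierStokesRegularity-22676) —
# the enstrophy-density identity and the STRAIN-THRESHOLD LIOUVILLE theorem

Support file (`--supports stmt-NavierStokesRegularity-22676`, helper; theorems only, no definitions,
no named facts).  For a smooth solution `(U, P)` of the rotated Leray profile system
`−νΔU + aU + a DU[y] + (BU − DU[By]) + DU[U] + ∇P = 0`, `div U = 0`, `B` skew, the vorticity
`ω = curl U` solves `νΔω − Dω[U − By + ay] = 2aω + Bω − DU[ω]` (landed: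
`rotatedProfile_vorticity_eq`).  Pairing with `ω` — the Coriolis term drops out pointwise,
`⟪ω, Bω⟫ = 0` — gives the EXACT ENSTROPHY-DENSITY IDENTITY (`driftOp_vorticity_norm_sq_eq`)

  `L |ω|² = 4a |ω|² − 2 ⟪ω, DU ω⟫ + 2ν |Dω|²`,   `L f = νΔf − Df[U − By + ay]`,

valid at EVERY rotation rate: the frame rotation is invisible to the enstrophy density, and the
only term of either sign is the vortex stretching `⟪ω, DU ω⟫ = ⟪ω, Sω⟫` (`S` the strain).  Hence
(`rotatedProfile_const_of_stretching_lt`): a smooth BOUNDED rotated profile whose stretching rate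
stays below the similarity damping on its vortical set,

  `⟪ω(y), DU(y) ω(y)⟫ < 2a |ω(y)|²` wherever `ω(y) ≠ 0`

(in particular if the largest eigenvalue of the strain is `< 2a` everywhere,
`rotatedProfile_const_of_strain_lt`), is CONSTANT — for every skew `B`: `|ω|²` is then a
polynomially bounded (`rotatedProfile_poly_bound_fderiv`) subsolution of `L`, constant by Tsai's
Lemma 5.1 for the skew drift (`isConst_of_driftOp_nonneg_skew_of_poly`), so `ω ≡ 0`, and a bounded
curl- and divergence-free field is constant (KNSS Lemma 3.1, `eq_of_curl_eq_zero_of_isDivFree_of_bounded`).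
Consequently (`noCoRotatingCore_of_subthreshold_stretching`) the crux `NoCoRotatingCore` — which is
all of bounded rotated-profile Liouville `X` (`noCoRotatingCore_iff_rotatedProfileLiouville`) —
is REDUCED to the statement that no bounded rotated profile stretches its own vorticity at rate
`≥ 2a` anywhere: a would-be profile must carry a point with `⟪ω, Sω⟫ ≥ 2a|ω|² > 0` (the modulus
form of the skeleton's open stub `stub_noStrainFedCore`, which asks the same of the spin component).

HONEST FRAMING. A conditional Liouville theorem and an exact identity; the crux `NoCoRotatingCore`,
`X` (Pineau–Vicol 2026, Conj. 1.1, bounded all-rotation-rates form) and Navier–Stokes regularity are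
NOT proved here.

References: T.-P. Tsai, ARMA 143 (1998), Lemma 5.1 [Tsai1998]; A. J. Majda, A. L. Bertozzi,
*Vorticity and Incompressible Flow* (2002), §1.1 and (2.5) [MajdaBertozziCUP2002]; G. Koch,
N. Nadirashvili, G. Seregin, V. Šverák, Acta Math. 203 (2009), Lemma 3.1 [KNSS2009].
-/

noncomputable section

-- the summit and its single sub-problem share the name (CONVENTIONS §1), as in every Theorems file
set_option linter.dupNamespace false

open MeasureTheory Set Function Filter Topology InnerProductSpace Metric
open scoped RealInnerProductSpace Laplacian ContDiff BigOperators
open Literature.Analysis.FluidPDE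

namespace Summit.NavierStokesRegularity.NavierStokesRegularity.Theorems.CoriolisHead

/-! ### The drift operator on `|W|²` -/

section NormSq

variable {ν a : ℝ}

/-- The drift–Laplace operator on the squared norm of a `C²` field:
`L |W|² (y) = 2 ⟪W(y), νΔW(y) − DW(y)[V(y) + a y]⟫ + 2ν |DW(y)|²` (`|·|` the Frobenius norm). -/
theorem driftOp_norm_sq_apply {W V : EuclideanSpace ℝ (Fin 3) → EuclideanSpace ℝ (Fin 3)}
    (hW : ContDiff ℝ 2 W) (y : EuclideanSpace ℝ (Fin 3)) :
    driftOp ν a V (fun z => ‖W z‖ ^ 2) y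
      = 2 * ⟪W y, ν • Laplacian.laplacian W y - fderiv ℝ W y (V y + a • y)⟫
        + 2 * ν * frobeniusNormSq (fderiv ℝ W y) := by
  have hfun : (fun z => ‖W z‖ ^ 2) = fun z => ⟪W z, W z⟫ := by
    funext z; rw [real_inner_self_eq_norm_sq]
  have hWd : DifferentiableAt ℝ W y := (hW.differentiable (by norm_num)) y
  rw [driftOp, hfun, laplacian_inner_self_eq hW y, fderiv_inner_apply ℝ hWd hWd,
    real_inner_comm (W y), inner_sub_right, inner_smul_right, real_inner_comm (W y) (fderiv ℝ W y _)]
  ring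

end NormSq

/-! ### The enstrophy-density identity of a rotated profile -/

section Enstrophy

variable {ν a : ℝ} {B : EuclideanSpace ℝ (Fin 3) →L[ℝ] EuclideanSpace ℝ (Fin 3)}
  {U : EuclideanSpace ℝ (Fin 3) → EuclideanSpace ℝ (Fin 3)} {P : EuclideanSpace ℝ (Fin 3) → ℝ}

/-- **The enstrophy-density identity of a rotated Leray profile, any skew frame rate.** For a smooth
divergence-free solution `(U, P)` (`P ∈ C²`) of
`−νΔU + aU + a DU[y] + (BU − DU[By]) + DU[U] + ∇P = 0` with `B` skew, `ω = curl U` satisfies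
`νΔ|ω|² − D|ω|²[U − By + ay] = 4a|ω|² − 2⟪ω, DU ω⟫ + 2ν|Dω|²`: the vorticity equation
(`rotatedProfile_vorticity_eq`) paired with `ω`, the Coriolis term vanishing by `⟪ω, Bω⟫ = 0`.
[cite: MajdaBertozziCUP2002, §1.1 (vector identities) and §2.1 eq. (2.5)] -/
theorem driftOp_vorticity_norm_sq_eq (hU : ContDiff ℝ (⊤ : ℕ∞) U) (hP : ContDiff ℝ 2 P)
    (hB : ∀ x, ⟪B x, x⟫ = 0) (hdiv : VectorCalculus.IsDivFree U)
    (heq : ∀ y, -(ν • Laplacian.laplacian U y) + a • U y + a • fderiv ℝ U y y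
      + (B (U y) - fderiv ℝ U y (B y)) + convect U U y + gradient P y = 0)
    (y : EuclideanSpace ℝ (Fin 3)) :
    driftOp ν a (fun z => U z - B z) (fun z => ‖curl U z‖ ^ 2) y
      = 4 * a * ‖curl U y‖ ^ 2 - 2 * ⟪curl U y, fderiv ℝ U y (curl U y)⟫
        + 2 * ν * frobeniusNormSq (fderiv ℝ (curl U) y) := by
  have hU3 : ContDiff ℝ 3 U := hU.of_le (by norm_cast)
  have hω2 : ContDiff ℝ 2 (curl U) := contDiff_curl (n := 2) (by exact_mod_cast hU3)
  rw [driftOp_norm_sq_apply hω2 y]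
  have hv := rotatedProfile_vorticity_eq hU hP hB hdiv heq y
  have hv' : ν • Laplacian.laplacian (curl U) y - fderiv ℝ (curl U) y (U y - B y + a • y)
      = (2 * a) • curl U y + B (curl U y) - fderiv ℝ U y (curl U y) := hv
  rw [hv', inner_sub_right, inner_add_right, inner_smul_right, real_inner_self_eq_norm_sq,
    real_inner_comm, hB (curl U y)]
  ring

end Enstrophy

/-! ### The strain-threshold Liouville theorem -/

section Threshold

/-- **Strain-threshold Liouville theorem for bounded rotated profiles (any rotation rate).**  A
smooth bounded rotated Leray profile (`ν, a > 0`, skew `B` of any size, `U ∈ C^∞` bounded, `P ∈ C²`,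
`div U = 0`) whose vortex stretching stays strictly below the similarity damping on its vortical set,
`⟪ω, DU ω⟫ < 2a|ω|²` wherever `ω = curl U ≠ 0`, is constant.  (`|ω|²` is a polynomially bounded
subsolution of the skew drift operator by the enstrophy-density identity and the pointwise gradient
bound, hence constant by Tsai's Lemma 5.1; the constant is `0` by strictness; then KNSS Lemma 3.1.)
[cite: Tsai1998, Lemma 5.1; KNSS2009, Lemma 3.1] -/
theorem rotatedProfile_const_of_stretching_lt (ν a : ℝ) (hν : 0 < ν) (ha : 0 < a)
    (B : EuclideanSpace ℝ (Fin 3) →L[ℝ] EuclideanSpace ℝ (Fin 3))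
    (U : EuclideanSpace ℝ (Fin 3) → EuclideanSpace ℝ (Fin 3)) (P : EuclideanSpace ℝ (Fin 3) → ℝ)
    (hU : ContDiff ℝ (⊤ : ℕ∞) U) (hP : ContDiff ℝ 2 P) (hB : ∀ x, inner ℝ (B x) x = 0)
    (hdiv : VectorCalculus.IsDivFree U)
    (heq : ∀ y, -(ν • Laplacian.laplacian U y) + a • U y + a • fderiv ℝ U y y
      + (B (U y) - fderiv ℝ U y (B y)) + convect U U y + gradient P y = 0)
    (hbdd : ∃ M : ℝ, ∀ y, ‖U y‖ ≤ M)
    (hstretch : ∀ y, curl U y ≠ 0 →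
      ⟪curl U y, fderiv ℝ U y (curl U y)⟫ < 2 * a * ‖curl U y‖ ^ 2) :
    ∃ b : EuclideanSpace ℝ (Fin 3), ∀ y, U y = b := by
  have hU2 : ContDiff ℝ 2 U := hU.of_le (by norm_cast)
  have hU3 : ContDiff ℝ 3 U := hU.of_le (by norm_cast)
  have hω2 : ContDiff ℝ 2 (curl U) := contDiff_curl (n := 2) (by exact_mod_cast hU3)
  set q : EuclideanSpace ℝ (Fin 3) → ℝ := fun z => ‖curl U z‖ ^ 2 with hq
  have hq2 : ContDiff ℝ 2 q := hω2.norm_sq ℝ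
  -- the source of the enstrophy identity is nonnegative under the threshold hypothesis
  have hsrc : ∀ y, 0 ≤ 4 * a * ‖curl U y‖ ^ 2 - 2 * ⟪curl U y, fderiv ℝ U y (curl U y)⟫ := by
    intro y
    by_cases h : curl U y = 0
    · rw [h]; simp
    · have := hstretch y h; linarith
  have hsub : ∀ y, 0 ≤ driftOp ν a (fun z => U z - B z) q y := by
    intro y
    rw [hq, driftOp_vorticity_norm_sq_eq hU hP hB hdiv heq y]
    exact add_nonneg (hsrc y) (mul_nonneg (by positivity) (frobeniusNormSq_nonneg _))
  -- polynomial growth of `|ω|²`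
  obtain ⟨C, N, hC0, hC⟩ := rotatedProfile_poly_bound_fderiv ν a hν ha B U P hU hP hB hdiv heq hbdd
  have hgrowth : ∀ y, |q y| ≤ (‖curlCLM‖ * C) ^ 2 * (1 + ‖y‖) ^ (2 * N) := by
    intro y
    have h1 : ‖curl U y‖ ≤ ‖curlCLM‖ * C * (1 + ‖y‖) ^ N := by
      calc ‖curl U y‖ ≤ ‖curlCLM‖ * ‖fderiv ℝ U y‖ := norm_curl_le U y
        _ ≤ ‖curlCLM‖ * (C * (1 + ‖y‖) ^ N) := by gcongr; exact hC y
        _ = ‖curlCLM‖ * C * (1 + ‖y‖) ^ N := by ring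
    rw [hq]
    dsimp only
    rw [abs_of_nonneg (sq_nonneg _), pow_mul', ← mul_pow]
    exact pow_le_pow_left₀ (norm_nonneg _) h1 2
  have hconst := isConst_of_driftOp_nonneg_skew_of_poly hν ha hB hq2 hsub hbdd hgrowth
  -- the constant value of `|ω|²` is `0`
  have hcurl : ∀ y, curl U y = 0 := by
    by_contra hne
    push Not at hne
    obtain ⟨y₀, hy₀⟩ := hne
    have hqfun : q = fun _ => q y₀ := funext fun z => hconst z y₀
    have h0 : driftOp ν a (fun z => U z - B z) q y₀ = 0 := by
      rw [hqfun]; exact driftOp_const _ _ _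
    rw [hq, driftOp_vorticity_norm_sq_eq hU hP hB hdiv heq y₀] at h0
    have h1 := hstretch y₀ hy₀
    have h2 := frobeniusNormSq_nonneg (fderiv ℝ (curl U) y₀)
    have h3 : 0 < ‖curl U y₀‖ ^ 2 := by positivity
    nlinarith
  obtain ⟨M, hM⟩ := hbdd
  exact ⟨U 0, fun y => eq_of_curl_eq_zero_of_isDivFree_of_bounded hU2 hcurl hdiv hM y 0⟩

/-- **Uniform strain threshold.**  A smooth bounded rotated Leray profile (any skew `B`) whose
velocity gradient satisfies `⟪v, DU(y) v⟫ ≤ λ|v|²` for all `y, v` with some `λ < 2a` — the largest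
eigenvalue of the strain `S = ½(DU + DUᵀ)` stays below `2a` — is constant. [cite: Tsai1998, Lemma 5.1] -/
theorem rotatedProfile_const_of_strain_lt (ν a : ℝ) (hν : 0 < ν) (ha : 0 < a)
    (B : EuclideanSpace ℝ (Fin 3) →L[ℝ] EuclideanSpace ℝ (Fin 3))
    (U : EuclideanSpace ℝ (Fin 3) → EuclideanSpace ℝ (Fin 3)) (P : EuclideanSpace ℝ (Fin 3) → ℝ)
    (hU : ContDiff ℝ (⊤ : ℕ∞) U) (hP : ContDiff ℝ 2 P) (hB : ∀ x, inner ℝ (B x) x = 0)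
    (hdiv : VectorCalculus.IsDivFree U)
    (heq : ∀ y, -(ν • Laplacian.laplacian U y) + a • U y + a • fderiv ℝ U y y
      + (B (U y) - fderiv ℝ U y (B y)) + convect U U y + gradient P y = 0)
    (hbdd : ∃ M : ℝ, ∀ y, ‖U y‖ ≤ M) {lam : ℝ} (hlam : lam < 2 * a)
    (hstrain : ∀ y v, ⟪v, fderiv ℝ U y v⟫ ≤ lam * ‖v‖ ^ 2) :
    ∃ b : EuclideanSpace ℝ (Fin 3), ∀ y, U y = b := by
  refine rotatedProfile_const_of_stretching_lt ν a hν ha B U P hU hP hB hdiv heq hbdd fun y hy => ?_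
  have h1 := hstrain y (curl U y)
  have h2 : 0 < ‖curl U y‖ ^ 2 := by positivity
  nlinarith

/-- **Reduction of the crux to a stretching bound.**  If every smooth bounded rotated Leray profile
(all `ν, a > 0`, all skew `B`) stretches its vorticity strictly below the similarity damping on its
vortical set (`⟪ω, DU ω⟫ < 2a|ω|²` wherever `ω ≠ 0`), then `NoCoRotatingCore` holds — indeed every
such profile is constant, so each defect term `(B ∂ₗU)ₗ` vanishes.  (Modulus form of the skeleton's
open stub `stub_noStrainFedCore`; the crux itself is NOT proved here.)
[cite: PineauVicol2026, Conjecture 1.1 (arXiv:2607.09619 p. 3)] -/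
theorem noCoRotatingCore_of_subthreshold_stretching
    (h : ∀ (ν a : ℝ), 0 < ν → 0 < a → ∀ (B : EuclideanSpace ℝ (Fin 3) →L[ℝ] EuclideanSpace ℝ (Fin 3))
      (U : EuclideanSpace ℝ (Fin 3) → EuclideanSpace ℝ (Fin 3)) (P : EuclideanSpace ℝ (Fin 3) → ℝ),
      ContDiff ℝ (⊤ : ℕ∞) U → ContDiff ℝ 2 P → (∀ x, inner ℝ (B x) x = 0) →
      VectorCalculus.IsDivFree U →
      (∀ y, -(ν • Laplacian.laplacian U y) + a • U y + a • fderiv ℝ U y y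
        + (B (U y) - fderiv ℝ U y (B y)) + convect U U y + gradient P y = 0) →
      (∃ M : ℝ, ∀ y, ‖U y‖ ≤ M) →
      ∀ y, curl U y ≠ 0 → ⟪curl U y, fderiv ℝ U y (curl U y)⟫ < 2 * a * ‖curl U y‖ ^ 2) :
    Summit.NavierStokesRegularity.NavierStokesRegularity.Theses.CoriolisHead.NoCoRotatingCore :=
  noCoRotatingCore_iff_rotatedProfileLiouville.2 fun ν a hν ha B U P hU hP hB hdiv heq hbdd =>
    rotatedProfile_const_of_stretching_lt ν a hν ha B U P hU hP hB hdiv heq hbdd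
      (h ν a hν ha B U P hU hP hB hdiv heq hbdd)

end Threshold

end Summit.NavierStokesRegularity.NavierStokesRegularity.Theorems.CoriolisHead

end
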